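import Mathlib

/-!
# Dyadic smooth partition of the sharp window `1_{[Q,2Q)}` on the integers

Stub `stub_windowPartition` of the crux `FanDecorrelation`
(`Summit.Parity.GeneralizedHardyLittlewood.Theses.LiouvilleMAD.FanDecorrelation`, stmt-Parity-13318),
line `SketchIdeator5` (card `mellin-height-law`); Mathlib only.

We construct two fixed `C^∞` profiles `φ₁` (vanishing off `(-1, 0)`) and `φ₂` (vanishing off
`(-1, 1)`) such that for every `Q ≥ 8` the indicator of `[Q, 2Q)` restricted to `ℤ` is the exact
signed sum of `2N + 8` dilated translates of them: `N` dyadic edge layers at each of the two sharp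
edges (centres `Q` and `2Q`, widths `s_i = Q / (8 · 2^i) ∈ [1, Q/8]`, `i < N`, with `2^N ≤ Q`) and
`8` interior tiles of width `Q/8` centred at `Q + l · Q/8`, `l < 8`.

Construction: `θ(x) = Real.smoothTransition (x + 1)` (`θ = 0` on `(-∞, -1]`, `θ = 1` on `[0, ∞)`),
`φ₁(y) = θ(2y) - θ(y)`, `φ₂(y) = θ(y) - θ(y - 1)`.  With `2^(k+3) ≤ Q < 2^(k+4)` and `N = k + 1` both
edge sums and the tile sum telescope (`Finset.sum_range_sub`, `Finset.sum_range_sub'`), the total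
being `θ((x - Q) / (Q/(8·2^N))) - θ((x - 2Q) / (Q/(8·2^N)))`; since the transition width `Q/(8·2^N)`
is `≤ 1`, on an integer `j` this is exactly `1_{[Q,2Q)}(j)`.

No new definitions: the profiles are the explicit lambdas
`fun y ↦ smoothTransition (2y + 1) - smoothTransition (y + 1)` and
`fun y ↦ smoothTransition (y + 1) - smoothTransition y`.
-/

namespace Summit.Parity.GeneralizedHardyLittlewood.Theorems.FanDecorrelation.WindowPartition

open Finset

/-- The edge profile `φ₁(y) = θ(2y) - θ(y)`, `θ(x) = smoothTransition (x + 1)`, is smooth.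
[folklore] -/
theorem phi1_contDiff {n : ℕ∞} :
    ContDiff ℝ n (fun y : ℝ => Real.smoothTransition (2 * y + 1) - Real.smoothTransition (y + 1)) :=
  (Real.smoothTransition.contDiff.comp ((contDiff_const.mul contDiff_id).add contDiff_const)).sub
    (Real.smoothTransition.contDiff.comp (contDiff_id.add contDiff_const))

/-- The tile profile `φ₂(y) = θ(y) - θ(y - 1)`, `θ(x) = smoothTransition (x + 1)`, is smooth.
[folklore] -/
theorem phi2_contDiff {n : ℕ∞} :
    ContDiff ℝ n (fun y : ℝ => Real.smoothTransition (y + 1) - Real.smoothTransition y) :=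
  (Real.smoothTransition.contDiff.comp (contDiff_id.add contDiff_const)).sub
    Real.smoothTransition.contDiff

/-- The edge profile `φ₁(y) = θ(2y) - θ(y)` vanishes off `(-1, 0)`, in particular off `[-2, 2]`.
[folklore] -/
theorem phi1_support (x : ℝ)
    (hx : Real.smoothTransition (2 * x + 1) - Real.smoothTransition (x + 1) ≠ 0) : |x| ≤ 2 := by
  by_contra h
  rw [not_le] at h
  apply hx
  rcases le_or_gt 0 x with h0 | h0
  · rw [Real.smoothTransition.one_of_one_le (by linarith : (1 : ℝ) ≤ 2 * x + 1),
      Real.smoothTransition.one_of_one_le (by linarith : (1 : ℝ) ≤ x + 1), sub_self]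
  · rw [abs_of_neg h0] at h
    rw [Real.smoothTransition.zero_of_nonpos (by linarith : 2 * x + 1 ≤ 0),
      Real.smoothTransition.zero_of_nonpos (by linarith : x + 1 ≤ 0), sub_self]

/-- The tile profile `φ₂(y) = θ(y) - θ(y - 1)` vanishes off `(-1, 1)`, in particular off `[-2, 2]`.
[folklore] -/
theorem phi2_support (x : ℝ)
    (hx : Real.smoothTransition (x + 1) - Real.smoothTransition x ≠ 0) : |x| ≤ 2 := by
  by_contra h
  rw [not_le] at h
  apply hx
  rcases le_or_gt 0 x with h0 | h0
  · rw [abs_of_nonneg h0] at h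
    rw [Real.smoothTransition.one_of_one_le (by linarith : (1 : ℝ) ≤ x + 1),
      Real.smoothTransition.one_of_one_le (by linarith : (1 : ℝ) ≤ x), sub_self]
  · rw [abs_of_neg h0] at h
    rw [Real.smoothTransition.zero_of_nonpos (by linarith : x + 1 ≤ 0),
      Real.smoothTransition.zero_of_nonpos (by linarith : x ≤ 0), sub_self]

/-- The step `θ(m / D)`, `θ(x) = smoothTransition (x + 1)`, of transition width `D ≤ 1` is the sharp
step `[0 ≤ m]` on integers `m`. [folklore] -/
theorem step_int (D : ℝ) (hD : 0 < D) (hD1 : D ≤ 1) (m : ℤ) :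
    Real.smoothTransition ((m : ℝ) / D + 1) = if 0 ≤ m then 1 else 0 := by
  split_ifs with hm
  · refine Real.smoothTransition.one_of_one_le ?_
    have h0 : (0 : ℝ) ≤ m := by exact_mod_cast hm
    have : 0 ≤ (m : ℝ) / D := div_nonneg h0 hD.le
    linarith
  · refine Real.smoothTransition.zero_of_nonpos ?_
    have hm' : (m : ℝ) ≤ -1 := by
      have : m ≤ -1 := by omega
      exact_mod_cast this
    have : (m : ℝ) / D ≤ -1 := by
      rw [div_le_iff₀ hD]
      nlinarith
    linarith

/-- Dyadic telescoping of the edge layers: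
`Σ_{i<N} [θ(2a/(W/2^i)) - θ(a/(W/2^i))] = θ(a/(W/2^N)) - θ(a/W)`. [folklore] -/
theorem edge_telescope (θ : ℝ → ℝ) (a W : ℝ) (N : ℕ) :
    ∑ i ∈ Finset.range N, (θ (2 * (a / (W / 2 ^ i)) + 1) - θ (a / (W / 2 ^ i) + 1)) =
      θ (a / (W / 2 ^ N) + 1) - θ (a / W + 1) := by
  have h : ∀ i : ℕ, 2 * (a / (W / 2 ^ i)) = a / (W / 2 ^ (i + 1)) := by
    intro i
    rw [div_div_eq_mul_div, div_div_eq_mul_div, pow_succ]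
    ring
  simp_rw [h]
  rw [Finset.sum_range_sub (fun i => θ (a / (W / 2 ^ i) + 1))]
  simp

/-- Telescoping of the interior tiles:
`Σ_{l<n} [θ((x - P - lW)/W) - θ((x - P - lW)/W - 1)] = θ((x - P)/W) - θ((x - P - nW)/W)`.
[folklore] -/
theorem tile_telescope (θ : ℝ → ℝ) (x P W : ℝ) (hW : W ≠ 0) (n : ℕ) :
    ∑ l ∈ Finset.range n, (θ ((x - (P + (l : ℝ) * W)) / W + 1) - θ ((x - (P + (l : ℝ) * W)) / W)) =
      θ ((x - P) / W + 1) - θ ((x - (P + (n : ℝ) * W)) / W + 1) := by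
  have h : ∀ l : ℕ, (x - (P + (l : ℝ) * W)) / W = (x - (P + ((l + 1 : ℕ) : ℝ) * W)) / W + 1 := by
    intro l
    push_cast
    field_simp
    ring
  have hsum := Finset.sum_range_sub' (fun l : ℕ => θ ((x - (P + (l : ℝ) * W)) / W + 1)) n
  simp only [Nat.cast_zero, zero_mul, add_zero] at hsum
  rw [← hsum]
  refine Finset.sum_congr rfl fun l _ => ?_
  rw [← h l]

/-- **Dyadic smooth partition of the sharp window on the integers** (stub `stub_windowPartition`,
line `SketchIdeator5` of crux stmt-Parity-13318).  There are two fixed smooth profiles `φ₁, φ₂`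
supported in `[-2, 2]` such that for every `Q ≥ 8` there are `N` with `2^N ≤ Q` and widths
`s_i ∈ [1, Q/8]` (`i < N`) with, for every integer `j`,
`1_{[Q,2Q)}(j) = Σ_{i<N} φ₁((j - Q)/s_i) - Σ_{i<N} φ₁((j - 2Q)/s_i) + Σ_{l<8} φ₂((j - Q - lQ/8)/(Q/8))`.
Witnesses: `φ₁(y) = θ(2y) - θ(y)`, `φ₂(y) = θ(y) - θ(y - 1)` with `θ(x) = smoothTransition (x + 1)`,
`N = k + 1` for `2^(k+3) ≤ Q < 2^(k+4)`, `s_i = Q/(8 · 2^i)`. [folklore] -/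
theorem stub_windowPartition :
    ∃ φ₁ φ₂ : ℝ → ℝ, ContDiff ℝ (⊤ : ℕ∞) φ₁ ∧ ContDiff ℝ (⊤ : ℕ∞) φ₂ ∧
      (∀ x : ℝ, φ₁ x ≠ 0 → |x| ≤ 2) ∧ (∀ x : ℝ, φ₂ x ≠ 0 → |x| ≤ 2) ∧
      ∀ Q : ℕ, 8 ≤ Q → ∃ N : ℕ, (2 : ℝ) ^ N ≤ Q ∧ ∃ s : ℕ → ℝ,
        (∀ i : ℕ, i < N → 1 ≤ s i ∧ 8 * s i ≤ Q) ∧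
        ∀ j : ℤ, (if (Q : ℤ) ≤ j ∧ j < 2 * Q then (1 : ℝ) else 0) =
          (∑ i ∈ Finset.range N, φ₁ (((j : ℝ) - Q) / s i)) -
            (∑ i ∈ Finset.range N, φ₁ (((j : ℝ) - 2 * Q) / s i)) +
            ∑ l ∈ Finset.range 8, φ₂ (((j : ℝ) - ((Q : ℝ) + l * ((Q : ℝ) / 8))) / ((Q : ℝ) / 8)) := by
  refine ⟨fun y => Real.smoothTransition (2 * y + 1) - Real.smoothTransition (y + 1),
    fun y => Real.smoothTransition (y + 1) - Real.smoothTransition y,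
    phi1_contDiff, phi2_contDiff, phi1_support, phi2_support, fun Q hQ => ?_⟩
  -- the dyadic exponent: `2^(k+3) ≤ Q < 2^(k+4)`, `N := k + 1`
  obtain ⟨k, hk1, hk2⟩ : ∃ k : ℕ, 2 ^ (k + 3) ≤ Q ∧ Q < 2 ^ (k + 4) := by
    have hQ0 : Q ≠ 0 := by omega
    have h3 : 3 ≤ Nat.log 2 Q := Nat.le_log_of_pow_le (by norm_num) (by simpa using hQ)
    refine ⟨Nat.log 2 Q - 3, ?_, ?_⟩
    · rw [Nat.sub_add_cancel h3]
      exact Nat.pow_log_le_self 2 hQ0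
    · have h := Nat.lt_pow_succ_log_self (b := 2) (by norm_num) Q
      rwa [show Nat.log 2 Q - 3 + 4 = (Nat.log 2 Q).succ by omega]
  have hk1' : (2 : ℝ) ^ (k + 3) ≤ Q := by exact_mod_cast hk1
  have hk2' : (Q : ℝ) < 2 ^ (k + 4) := by exact_mod_cast hk2
  have hQpos : (0 : ℝ) < Q := Nat.cast_pos.mpr (by omega)
  refine ⟨k + 1, ?_, fun i => (Q : ℝ) / 8 / 2 ^ i, ?_, ?_⟩
  · calc (2 : ℝ) ^ (k + 1) ≤ 2 ^ (k + 3) := pow_le_pow_right₀ (by norm_num) (by omega)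
      _ ≤ Q := hk1'
  · intro i hi
    refine ⟨?_, ?_⟩
    · rw [le_div_iff₀ (by positivity), le_div_iff₀ (by norm_num), one_mul]
      calc (2 : ℝ) ^ i * 8 ≤ 2 ^ k * 8 :=
          mul_le_mul_of_nonneg_right (pow_le_pow_right₀ (by norm_num) (by omega)) (by norm_num)
        _ = 2 ^ (k + 3) := by ring
        _ ≤ Q := hk1'
    · calc 8 * ((Q : ℝ) / 8 / 2 ^ i) = Q / 2 ^ i := by ring
        _ ≤ Q := div_le_self hQpos.le (one_le_pow₀ (by norm_num))
  · intro j
    have hW : (Q : ℝ) / 8 ≠ 0 := by positivity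
    have hD : (0 : ℝ) < (Q : ℝ) / 8 / 2 ^ (k + 1) := by positivity
    have hD1 : (Q : ℝ) / 8 / 2 ^ (k + 1) ≤ 1 := by
      rw [div_div, div_le_one (by positivity)]
      calc (Q : ℝ) ≤ 2 ^ (k + 4) := hk2'.le
        _ = 8 * 2 ^ (k + 1) := by ring
    rw [edge_telescope Real.smoothTransition, edge_telescope Real.smoothTransition,
      tile_telescope Real.smoothTransition _ _ _ hW]
    have e8 : (j : ℝ) - ((Q : ℝ) + ((8 : ℕ) : ℝ) * ((Q : ℝ) / 8)) = (j : ℝ) - 2 * Q := by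
      push_cast
      ring
    have e1 : (j : ℝ) - (Q : ℝ) = (((j - (Q : ℤ)) : ℤ) : ℝ) := by push_cast; ring
    have e2 : (j : ℝ) - 2 * (Q : ℝ) = (((j - 2 * (Q : ℤ)) : ℤ) : ℝ) := by push_cast; ring
    rw [e8, e1, e2, step_int _ hD hD1, step_int _ hD hD1]
    by_cases hQj : (Q : ℤ) ≤ j
    · by_cases hj2 : j < 2 * Q
      · rw [if_pos ⟨hQj, hj2⟩, if_pos (by omega), if_neg (by omega)]
        ring
      · rw [if_neg (fun h => hj2 h.2), if_pos (by omega), if_pos (by omega)]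
        ring
    · rw [if_neg (fun h => hQj h.1), if_neg (by omega), if_neg (by omega)]
      ring

end Summit.Parity.GeneralizedHardyLittlewood.Theorems.FanDecorrelation.WindowPartition
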